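import Summits.BirchSwinnertonDyer.BirchSwinnertonDyer.Theorems.PrintCFramJZeroThreeTraceForm
import Summits.BirchSwinnertonDyer.Rank1Residual.X12.JZeroThreeUnitRegime
import HarnessLib

/-!
# K12r@3 — ROUTE U at `p = 3` on the `j = 0` leaf with the trace form DISCHARGED: seat p4's
# `JZeroThree.bsdp_three_of_thm120_unitRegime` ∘ seat p3's `hss_three_of_sq_twist`
# (cell `bsd-print-cfram`, seat p3 g1; the «3-unit regime» of crux C1 `CMRamifiedThreeBSD`,
# stmt-BirchSwinnertonDyer-20371)

HONEST FRAMING (cell `bsd-print-cfram`, run/shared/lean/pub/bsd-print-cfram/, D-0131 (2) print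
tier; verbatim in every file of the cell): the cell works the partition leaf
`CornerF ∧ p ramified in the CM field K` (LADDER-BSD row K7r = B13; W-ALL row 12r) in PARTITION
currency — a leaf or a cell counts only when its theorem is in the kernel BY NAME. Nothing here is a
Literature statement, no named fact is introduced, nothing is asserted about BSD; beyond-print: NO.

ONE theorem: `bsdp_three_of_thm120_unitRegime_of_sq_twist` — p4's `bsdp_three_of_thm120_unitRegime`
(ROUTE U = Kriz–Li 2019 Thm. 1.20 ∧ Rem. 3.10 + Gross–Zagier–Kolyvagin + GZK + modularity + the
twin's `3`-part + the descent inputs, at `p = 3`, `j = 0`) with its one non-certificate binder `hss`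
REPLACED by the Mordell data of `W` (`C • W = y² = x³ + d·m²`, `d` squarefree), the per-curve facts
`h2` / `hbad` of `PrintCFramJZeroThreeTraceForm` §4, and two FINITE conditions on the character `ψ`
(`ψ² = 1`; `ψ(ℓ) = (d/ℓ)` at the primes `ℓ ≡ 1 (mod 3)`, `ℓ ∤ 3N`). Every other binder is p4's,
verbatim and in the same order. PER CLASS in its binders; a theorem SHAPE for the planner's «3-unit
regime» split of `stub_jZeroRankOneBSDThree`, not a closure of it.
References: [KrizLi2019] Thm. 1.20 (pp. 7–8), Rem. 3.10 (p. 26), §7.1, §10.3; [GrossZagier1986] V.§2;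
[Miller2011LMS] Def. 1.1; `X12/JZeroThreeUnitRegime.lean` (p4), `X12/O11/RouteUTheoremU.lean` (bsd-cm).
-/

set_option linter.dupNamespace false
set_option autoImplicit false

noncomputable section

open scoped Classical
open NumberField Field WeierstrassCurve
open Literature.NumberTheory.EllipticCurves Literature.NumberTheory.EllipticCurves.KrizLi2019
  Literature.NumberTheory.EllipticCurves.ModularForms

namespace Summit.BirchSwinnertonDyer.BirchSwinnertonDyer.Theorems.PrintCFram


/-- **BSD(W, 3) in the 3-UNIT REGIME with the trace form discharged**: seat p4's
`JZeroThree.bsdp_three_of_thm120_unitRegime` (ROUTE U = Kriz–Li Thm. 1.20 ∧ Rem. 3.10 +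
Gross–Zagier–Kolyvagin + GZK + modularity + the twin's `3`-part + the descent inputs, at `p = 3`,
`j = 0`) with its `hss` binder REPLACED by the Mordell data of `W` (`C • W = y² = x³ + d·m²`, `d`
squarefree), the two per-curve facts `h2` / `hbad` of §4, and the two FINITE conditions on the
character `ψ`: `ψ² = 1` and `ψ(ℓ) = (d/ℓ)` at the primes `ℓ ≡ 1 (mod 3)`, `ℓ ∤ 3N`. Every other
binder is p4's, verbatim and in the same order (`hj` is implied by the Mordell model but kept, as
p4's decl consumes it). PER CLASS in its binders; a theorem SHAPE for the planner's «3-unit regime»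
split of `stub_jZeroRankOneBSDThree`, not a closure of it; beyond-print: NO.
[cite: KrizLi2019, Thm. 1.20 (pp. 7–8), Rem. 3.10 (p. 26), §7.1 (p. 42), §10.3]
[cite: GrossZagier1986, V.§2 (pp. 310–312)] [cite: Miller2011LMS, Def. 1.1] -/
theorem bsdp_three_of_thm120_unitRegime_of_sq_twist
    (hKL : KrizLi2019.thm120_padicLogHeegner_unit_of_bernoulli)
    (hRem : KrizLi2019.rem310_padicLogHeegner_integral)
    (W : WeierstrassCurve ℚ) [W.IsElliptic] [W.IsGloballyMinimal] (hj : W.j = 0)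
    -- the Mordell model of `W` and the two per-curve facts of §4
    {d : ℤ} (hd : Squarefree d) {m : ℚ} (hm : m ≠ 0)
    (hW : ∃ C : VariableChange ℚ, C • W = mordellCurve ((d : ℚ) * m ^ 2))
    (h2 : (haveI : Fact (Nat.Prime 2) := ⟨Nat.prime_two⟩; W.HasGoodReductionAtPrime 2) →
      W.LFunction 2 = 0)
    (hbad : ∀ ℓ : ℕ, (hℓ : ℓ.Prime) → (ℓ : ℤ) ∣ d → ℓ ≠ 2 →
      ¬ (haveI := Fact.mk hℓ; W.HasGoodReductionAtPrime ℓ))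
    [NeZero (W.conductorNorm ℤ)] (K : Type) [Field K] [NumberField K]
    [NeZero (NumberField.discr K).natAbs]
    (D : ModularParametrizationData W (W.conductorNorm ℤ))
    (H : HeegnerDatum (W.conductorNorm ℤ) (NumberField.discr K)) (ι : K →+* ℂ)
    (ιp : K →+* ℚ_[3]) (P : (W.baseChange K).toAffine.Point)
    -- T-U0's displayed inputs
    (hGZ : gross_zagier (W.conductorNorm ℤ) W K)
    (hKo : kolyvagin (W.conductorNorm ℤ) W K)
    (hGZK : rank_eq_analyticRank_of_analyticRank_le_one) (hmod : hasEntireLFunction_rat)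
    (hK : IsImaginaryQuadratic K) (hd4 : NumberField.discr K < -4)
    (hHN : SatisfiesHeegnerHypothesis (W.conductorNorm ℤ) K)
    (hP : WeierstrassCurve.Affine.Point.map ι.toRatAlgHom P = heegnerPointComplex D H)
    (hr : W.analyticRank = 1)
    (hLt : (W.quadraticTwist (NumberField.discr K : ℚ)).entireLFunction 1 ≠ 0)
    (Wd : WeierstrassCurve ℚ) [Wd.IsElliptic] [Wd.IsGloballyMinimal] (Cd : VariableChange ℚ)
    (hWd : Cd • W.quadraticTwist (NumberField.discr K : ℚ) = Wd)
    (htw : ∃ q : ℚ, Wd.entireLFunction 1 / (Wd.realPeriodRat : ℂ) = (q : ℂ) ∧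
      padicValRat 3 q = (padicValNat 3 Wd.shaOrder : ℤ) + padicValNat 3 Wd.tamagawaProduct -
        2 * padicValNat 3 Wd.torsionOrder)
    (htam : padicValNat 3 Wd.tamagawaProduct = padicValNat 3 W.tamagawaProduct)
    (hu : padicValRat 3 (Cd.u : ℚ) = 0)
    (htamW : ¬ 3 ∣ W.tamagawaProduct)
    (hSW : ∀ [Finite W.sha], ¬ 3 ∣ W.shaOrder) (hSd : ∀ [Finite Wd.sha], ¬ 3 ∣ Wd.shaOrder)
    -- Thm. 1.20's displayed inputs, `hss` replaced by `hψ2` / `hψ`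
    (f : ℕ) [NeZero f] (ψ : DirichletCharacter ℚ_[3] f) (ω : DirichletCharacter ℚ_[3] 3)
    (hψ : ψ.IsPrimitive) (hω : KrizLi2019.IsTeichmullerCharacter ω) (hψ2 : ψ * ψ = 1)
    (hψval : ∀ ℓ : ℕ, ℓ.Prime → ¬ (ℓ ∣ 3 * W.conductorNorm ℤ) → ℓ % 3 = 1 →
      ψ (ℓ : ZMod f) = ((jacobiSym d ℓ : ℤ) : ℚ_[3]))
    (h1a : ψ (3 : ZMod f) ≠ 1) (h1b : KrizLi2019.primVal (KrizLi2019.invMulOmega ψ ω) 3 ≠ 1)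
    (h3 : ∀ ℓ : ℕ, (hℓ : ℓ.Prime) → ℓ ≠ 3 →
      (haveI := Fact.mk hℓ;
        ¬ W.HasGoodReductionAtPrime ℓ ∧ ¬ W.HasMultiplicativeReductionAtPrime ℓ) →
      ψ (ℓ : ZMod f) ≠ 1 ∧ KrizLi2019.primVal (KrizLi2019.invMulOmega ψ ω) ℓ ≠ 1)
    (εK : DirichletCharacter ℚ_[3] (NumberField.discr K).natAbs)
    (hεK : KrizLi2019.IsKroneckerCharacterOf K εK)
    (hB : ¬ (‖KrizLi2019.bernoulliOnePrim (KrizLi2019.bernoulliCharOne ψ εK) *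
        KrizLi2019.bernoulliOnePrim (KrizLi2019.bernoulliCharTwo ψ εK ω)‖ ≤ ((3 : ℕ) : ℝ)⁻¹))
    -- T-U2's displayed inputs
    [Finite (AddCommGroup.torsion (W.baseChange K).toAffine.Point)]
    (crd : (W.baseChange K).toAffine.Point →+ ℤ) (g : (W.baseChange K).toAffine.Point)
    (hg : crd g = 1) (hker : ∀ x, crd x = 0 → IsOfFinAddOrder x)
    (hiv : ∀ x : (W.baseChange K).toAffine.Point, 3 • x = 0 → x = 0)
    (hg0 : ‖Castella2018.padicLogOmega W 3 ιp g‖ = 1) :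
    BSDp W 3 :=
  Rank1Residual.X12.JZeroThree.bsdp_three_of_thm120_unitRegime hKL hRem W hj K D H ι ιp P hGZ hKo hGZK
    hmod hK hd4 hHN hP hr hLt
    Wd Cd hWd htw htam hu htamW hSW hSd f ψ ω hψ hω
    (hss_three_of_sq_twist W hd hm hW h2 hbad ψ ω hω hψ2 hψval) h1a h1b h3 εK hεK hB crd g hg hker
    hiv hg0

end Summit.BirchSwinnertonDyer.BirchSwinnertonDyer.Theorems.PrintCFram

end
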